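import Mathlib
import Literature.Computability.AlgebraicComplexity.BCGPUInfiniteGroupsProofs

/-!
# `SeparationDegreeCost`, stub `stub_approxEmbedding`: approximate separators give approximate
# restrictions of `⊕ᵢ ⟨dᵢ, dᵢ, dᵢ⟩` (BCGPU 2024, eq. (2.2), `η`-approximate form)

Route `MatrixMultiplication/GLnSeparatingDesigns`, crux `SeparationDegreeCost`
(stmt-MatrixMultiplication-18361, BCGPU 2024 Cor. 2.8 with its border clause), line
`SketchIdeator1`, stub `stub_approxEmbedding` (support file).

Setting: a family `ρᵢ : G →* GL_{dᵢ}(ℂ)`, `i < r`, of matrix representations of a group `G`, and for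
every tolerance `η > 0` finite sets `X, Y, Z ⊆ G` of sizes `≥ N₁, N₂, N₃` such that every target
`(x₀, z₀) ∈ X × Z` has an `η`-approximate separator `f ∈ RepFun(ρ)` (the span of the matrix
coefficients `g ↦ (ρᵢ g)_{ab}`): `|f(x y⁻¹ y' z⁻¹) - 1| ≤ η` if `x = x₀ ∧ y = y' ∧ z = z₀` and
`|f(x y⁻¹ y' z⁻¹)| ≤ η` otherwise (`x ∈ X`, `y, y' ∈ Y`, `z ∈ Z`).

Claim (`stub_approxEmbedding`): for every `η > 0` there is a tensor `T` of format
`(N₁ × N₃) × (N₁ × N₂) × (N₂ × N₃)` which is a restriction of `⊕ᵢ ⟨dᵢ, dᵢ, dᵢ⟩`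
(`matMulDirectSum ℂ d d d`) and is entrywise `η`-close to `⟨N₁, N₂, N₃⟩`
(`matMulTensor ℂ N₁ N₂ N₃`).

Proof (the `η`-approximate form of J. Blasiak, H. Cohn, J. A. Grochow, K. Pratt, C. Umans, *Finite
matrix multiplication algorithms from infinite groups*, arXiv:2410.14905, proof of Thm. 2.2,
eq. (2.2), p. 12; a variation of the tree's `tensorRestrictsTo_matMulDirectSum_of_separating`):
fix `η`, take the sets `X, Y, Z` and injections `eX : Fin N₁ ↪ X`, `eY : Fin N₂ ↪ Y`,
`eZ : Fin N₃ ↪ Z`; for each row/column pair `a = (a₁, a₃)` choose a separator `f_a ∈ RepFun(ρ)` for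
the target `(eX a₁, eZ a₃)` and coefficients `M_a` of `f_a` in the matrix coefficients. Put
`T a b c := f_a (eX b₁ · (eY b₂)⁻¹ · eY c₁ · (eZ c₂)⁻¹)`. With `α(b) = (ρᵢ(eX b₁ (eY b₂)⁻¹))ᵢ`,
`β(c) = (ρᵢ(eY c₁ (eZ c₂)⁻¹))ᵢ` in the block algebra `⊕ᵢ ℂ^{dᵢ×dᵢ}` and the linear forms
`γ_a(A) = ∑_{(i,u,v)} M_a(i,u,v) A_{i,u,v}` one has EXACTLY `T a b c = γ_a(α(b) β(c))`
(multiplicativity of the `ρᵢ`), so `T` is a restriction of the structure tensor of the block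
algebra (`tensorRestrictsTo_structureTensor_of_factors`), which is `⊕ᵢ ⟨dᵢ, dᵢ, dᵢ⟩`
(`structureTensor_blockBasis_eq_matMulDirectSum`). Entrywise, the separator condition
`eX b₁ = eX a₁ ∧ eY b₂ = eY c₁ ∧ eZ c₂ = eZ a₃` is, by injectivity, the support condition
`a₁ = b₁ ∧ b₂ = c₁ ∧ a₃ = c₂` of `⟨N₁, N₂, N₃⟩`, so the two separator inequalities are the
entrywise `η`-closeness. The triple-product-property clause of the hypothesis is not used.

## References

* J. Blasiak, H. Cohn, J. A. Grochow, K. Pratt, C. Umans, *Finite matrix multiplication algorithms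
  from infinite groups*, arXiv:2410.14905 (ITCS 2025): Def. 2.1, Thm. 2.2 (proof, eq. (2.2), p. 12),
  Cor. 2.8.
-/

-- `Summit.MatrixMultiplication.MatrixMultiplication.…` is the tree's mandated summit-side namespace
-- (Sub = Summit), flagged by `dupNamespace`.
set_option linter.dupNamespace false

open scoped BigOperators
open Literature.Computability.AlgebraicComplexity

namespace Summit.MatrixMultiplication.MatrixMultiplication.Theorems

/-- **Stub S7 (approximate embedding; BCGPU 2024, eq. (2.2), `η`-approximate form).** If for every
`η > 0` there are finite sets `X, Y, Z ⊆ G` of sizes `≥ N₁, N₂, N₃` all of whose targets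
`(x₀, z₀) ∈ X × Z` carry `η`-approximate separators in `RepFun(ρ)`, then for every `η > 0` some
restriction `T` of `⊕ᵢ ⟨dᵢ, dᵢ, dᵢ⟩` of format `(N₁ × N₃) × (N₁ × N₂) × (N₂ × N₃)` is entrywise
`η`-close to `⟨N₁, N₂, N₃⟩`: `T a b c = f_a(eX b₁ (eY b₂)⁻¹ eY c₁ (eZ c₂)⁻¹)` for injections
`eX, eY, eZ` of `Fin Nᵢ` into `X, Y, Z` and chosen separators `f_a`, which factors exactly through
the block algebra as `γ_a(α(b) β(c))` with `α(b) = (ρᵢ(eX b₁ (eY b₂)⁻¹))ᵢ`,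
`β(c) = (ρᵢ(eY c₁ (eZ c₂)⁻¹))ᵢ`, `γ_a = ` the coefficient functional of `f_a`. The TPP clause is
not used. -/
theorem stub_approxEmbedding {G : Type*} [Group G] [DecidableEq G] {r : ℕ} (d : Fin r → ℕ)
    (ρ : ∀ i, G →* Matrix.GeneralLinearGroup (Fin (d i)) ℂ) (N₁ N₂ N₃ : ℕ)
    (h : ∀ η : ℝ, 0 < η → ∃ X Y Z : Finset G, N₁ ≤ X.card ∧ N₂ ≤ Y.card ∧ N₃ ≤ Z.card ∧
      (∀ x ∈ X, ∀ x' ∈ X, ∀ y ∈ Y, ∀ y' ∈ Y, ∀ z ∈ Z, ∀ z' ∈ Z,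
        x * y⁻¹ * y' * z⁻¹ = x' * z'⁻¹ → x = x' ∧ y = y' ∧ z = z') ∧
      ∀ x₀ ∈ X, ∀ z₀ ∈ Z, ∃ f ∈ repFun d ρ, ∀ x ∈ X, ∀ y ∈ Y, ∀ y' ∈ Y, ∀ z ∈ Z,
        ((x = x₀ ∧ y = y' ∧ z = z₀) → ‖f (x * y⁻¹ * y' * z⁻¹) - 1‖ ≤ η) ∧
        (¬ (x = x₀ ∧ y = y' ∧ z = z₀) → ‖f (x * y⁻¹ * y' * z⁻¹)‖ ≤ η)) :
    ∀ η : ℝ, 0 < η → ∃ T : Fin N₁ × Fin N₃ → Fin N₁ × Fin N₂ → Fin N₂ × Fin N₃ → ℂ,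
      TensorRestrictsTo (matMulDirectSum ℂ d d d) T ∧
        ∀ a b c, ‖T a b c - matMulTensor ℂ N₁ N₂ N₃ a b c‖ ≤ η := by
  intro η hη
  obtain ⟨X, Y, Z, hX, hY, hZ, -, hsep⟩ := h η hη
  -- injections `Fin N₁ ↪ X`, `Fin N₂ ↪ Y`, `Fin N₃ ↪ Z`
  obtain ⟨eX, heX, hiX⟩ : ∃ e : Fin N₁ → G, (∀ a, e a ∈ X) ∧ Function.Injective e :=
    ⟨fun a => (X.equivFin.symm (Fin.castLE hX a) : G), fun a => (X.equivFin.symm _).2,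
      Subtype.val_injective.comp (X.equivFin.symm.injective.comp (Fin.castLE_injective hX))⟩
  obtain ⟨eY, heY, hiY⟩ : ∃ e : Fin N₂ → G, (∀ a, e a ∈ Y) ∧ Function.Injective e :=
    ⟨fun a => (Y.equivFin.symm (Fin.castLE hY a) : G), fun a => (Y.equivFin.symm _).2,
      Subtype.val_injective.comp (Y.equivFin.symm.injective.comp (Fin.castLE_injective hY))⟩
  obtain ⟨eZ, heZ, hiZ⟩ : ∃ e : Fin N₃ → G, (∀ a, e a ∈ Z) ∧ Function.Injective e :=
    ⟨fun a => (Z.equivFin.symm (Fin.castLE hZ a) : G), fun a => (Z.equivFin.symm _).2,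
      Subtype.val_injective.comp (Z.equivFin.symm.injective.comp (Fin.castLE_injective hZ))⟩
  -- the separators `f_a ∈ RepFun(ρ)` of the targets `(eX a₁, eZ a₃)`
  choose f hfmem hfsep using
    fun a : Fin N₁ × Fin N₃ => hsep (eX a.1) (heX a.1) (eZ a.2) (heZ a.2)
  -- `f̂_a`: coefficients of the separators in the matrix coefficients
  have hM : ∀ a : Fin N₁ × Fin N₃, ∃ M : BlockIndex d → ℂ,
      ∑ k, M k • matrixCoeffFun d ρ k = f a := fun a => by
    have hm := hfmem a
    rw [repFun_eq_span_range] at hm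
    exact (Submodule.mem_span_range_iff_exists_fun ℂ).1 hm
  choose M hM using hM
  -- the tensor `T a b c = f_a (eX b₁ (eY b₂)⁻¹ eY c₁ (eZ c₂)⁻¹)`
  obtain ⟨T, hT⟩ : ∃ T : Fin N₁ × Fin N₃ → Fin N₁ × Fin N₂ → Fin N₂ × Fin N₃ → ℂ,
      ∀ a b c, T a b c = f a (eX b.1 * (eY b.2)⁻¹ * eY c.1 * (eZ c.2)⁻¹) :=
    ⟨_, fun _ _ _ => rfl⟩
  refine ⟨T, ?_, fun a b c => ?_⟩
  · -- `T` factors through the block algebra: `T a b c = γ_a (α b * β c)`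
    let α : Fin N₁ × Fin N₂ → BlockAlgebra ℂ d := fun b i =>
      ((ρ i (eX b.1 * (eY b.2)⁻¹) : Matrix.GeneralLinearGroup (Fin (d i)) ℂ) :
        Matrix (Fin (d i)) (Fin (d i)) ℂ)
    let β : Fin N₂ × Fin N₃ → BlockAlgebra ℂ d := fun c i =>
      ((ρ i (eY c.1 * (eZ c.2)⁻¹) : Matrix.GeneralLinearGroup (Fin (d i)) ℂ) :
        Matrix (Fin (d i)) (Fin (d i)) ℂ)
    let γ : Fin N₁ × Fin N₃ → BlockAlgebra ℂ d →ₗ[ℂ] ℂ := fun a =>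
      { toFun := fun A => ∑ k : BlockIndex d, M a k * A k.1 k.2.1 k.2.2
        map_add' := fun A B => by
          simp only [Pi.add_apply, Matrix.add_apply, mul_add, Finset.sum_add_distrib]
        map_smul' := fun c A => by
          simp only [Pi.smul_apply, Matrix.smul_apply, smul_eq_mul, RingHom.id_apply,
            Finset.mul_sum, mul_left_comm] }
    rw [← structureTensor_blockBasis_eq_matMulDirectSum]
    refine tensorRestrictsTo_structureTensor_of_factors (blockBasis ℂ d) α β γ T fun a b c => ?_
    have e := congrFun (hM a) (eX b.1 * (eY b.2)⁻¹ * eY c.1 * (eZ c.2)⁻¹)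
    rw [Finset.sum_apply] at e
    simp only [Pi.smul_apply, smul_eq_mul] at e
    rw [hT, ← e]
    show _ = ∑ k : BlockIndex d, M a k * (α b * β c) k.1 k.2.1 k.2.2
    refine Finset.sum_congr rfl fun k _ => ?_
    congr 1
    simp only [α, β, matrixCoeffFun, Pi.mul_apply, ← Units.val_mul, ← map_mul, mul_assoc]
  · -- entrywise `η`-closeness from the two separator inequalities
    obtain ⟨h1, h2⟩ :=
      hfsep a (eX b.1) (heX b.1) (eY b.2) (heY b.2) (eY c.1) (heY c.1) (eZ c.2) (heZ c.2)
    rw [hT]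
    simp only [matMulTensor]
    split_ifs with hc
    · exact h1 ⟨congrArg eX hc.1.symm, congrArg eY hc.2.1, congrArg eZ hc.2.2.symm⟩
    · rw [sub_zero]
      exact h2 fun hc' => hc ⟨(hiX hc'.1).symm, hiY hc'.2.1, (hiZ hc'.2.2).symm⟩

end Summit.MatrixMultiplication.MatrixMultiplication.Theorems
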